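import Summits.CriticalPhenomena.PercolationContinuityZ3.Theorems.PercNearOneGluingNoHeavyLowerTailSahiC3CubeCertCheck

/-!
# `NoHeavyLowerTail` (stmt-CriticalPhenomena-4575) — the algebra of `n`-copy (degree-`d` tensor-Bernstein) certificates, for EVERY degree:
# coefficient vectors, multiplication by a corner table, Kronecker numbers with a fixed position base, and the digit criterion

Support file, seat `prim-l12-p5` (gen 5), `--supports stmt-CriticalPhenomena-4575`.  Measure-free layer, generic in the degree `d`
(the tree has the two-, three- and four-copy algebras `…OneCutCertKronecker`, `…CovTransferCertAlgebra`, `…FourCopyCertAlgebra`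
with hard-wired position bases `3, 4, 5`).  Purpose: Sahi's `E_n` for ALL `n` on the cube `{0,1}^m` (companion files
`…SahiRecursionCert`, `…SahiCubeFourResidualFive/Six`): the Lieb–Sahi recursion that DEFINES the tree's `sahiE` is run symbolically on
degree-indexed coefficient vectors, one degree per order.

* `bernW d t j = t^j (1 − t)^{d−j}`; a degree-`d` COEFFICIENT VECTOR is `c : (Fin m → Fin (d+1)) → ℤ`, evaluated by
  `evB d c x = Σ_k c_k Π_i bernW d (x_i) (k_i)`; `evB_nonneg`: nonnegative coefficients ⇒ nonnegative on the unit cube.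
* `convT d c T` — the degree-`(d+1)` vector of the product of `evB d c` with the multilinear polynomial `ML T` of a corner table `T`
  (`evB_convT`); written as a sum over corners with the clamped difference key `subKey`, so that `|convT| ≤ 2^m · sup|c|` is immediate
  (`abs_convT_le`).
* Kronecker numbers with a FIXED position base `b` (independent of the degree, so that the recursion can raise the degree):
  `posB b k = Σ_i k_i b^i`, `cornerPos b g`, `krB b M d c = Σ_k c_k M^{posB b k}`, `KRB b M T = Σ_g T g M^{cornerPos b g}`;
  `krB_convT`: `krB (convT c T) = krB c · KRB T` (exact, no carries needed).
* `coef_nonneg_of_digit_ge` — the digit criterion at base `b = d + 1` (positions = `finFunctionFinEquiv`): if all `|c_k| < 2^(σ−1)` and the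
  `(d+1)^m` lowest base-`2^σ` digits of `krB (d+1) (2^σ) d c + 2^(σ−1)·Σ_j (2^σ)^j` are `≥ 2^(σ−1)`, every `c_k ≥ 0`.
* `krNB`/`krLB` — fast Kronecker numbers of list tables by shifts for any position base (`krNB_eq`), `krTB` for bitmask tables.

Nothing here mentions percolation; no proposition about the crux is asserted.
-/

namespace Summit.CriticalPhenomena.PercolationContinuityZ3.Theorems.NCopyCert

open Finset OneCutCert SahiC3Cube
open scoped BigOperators

variable {m : ℕ}

/-! ## Degree-`d` Bernstein weights and coefficient vectors -/

/-- The scaled Bernstein weight of degree `d`: `t^j (1 − t)^{d − j}`. [this work] -/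
def bernW (d : ℕ) (t : ℝ) (j : ℕ) : ℝ := t ^ j * (1 - t) ^ (d - j)

/-- The weights are nonnegative on `[0,1]`. [folklore] -/
theorem bernW_nonneg (d : ℕ) {t : ℝ} (ht : 0 ≤ t ∧ t ≤ 1) (j : ℕ) : 0 ≤ bernW d t j :=
  mul_nonneg (pow_nonneg ht.1 _) (pow_nonneg (sub_nonneg.2 ht.2) _)

/-- Degree zero: `bernW 0 t 0 = 1`. [this work] -/
theorem bernW_zero (t : ℝ) : bernW 0 t 0 = 1 := by simp [bernW]

/-- Raising the degree by one Bernoulli factor: `bernW (d+1) t (j + b) = bernW d t j · (t if b else 1 − t)` for `j ≤ d`. [this work] -/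
theorem bernW_succ (d : ℕ) (t : ℝ) {j : ℕ} (hj : j ≤ d) (b : Bool) :
    bernW (d + 1) t (j + b.toNat) = bernW d t j * (if b then t else 1 - t) := by
  cases b
  · simp only [bernW, Bool.toNat_false, add_zero, Bool.false_eq_true, if_false]
    rw [show d + 1 - j = (d - j) + 1 by omega, pow_succ]
    ring
  · simp only [bernW, Bool.toNat_true, if_true]
    rw [show d + 1 - (j + 1) = d - j by omega, pow_succ]
    ring

/-- Evaluation of a degree-`d` integer coefficient vector in the scaled tensor-Bernstein basis at `x`. [this work] -/
def evB (d : ℕ) (c : (Fin m → Fin (d + 1)) → ℤ) (x : Fin m → ℝ) : ℝ :=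
  ∑ k, (c k : ℝ) * ∏ i, bernW d (x i) (k i)

/-- **Positivity criterion**: nonnegative coefficients give a nonnegative value on the unit cube. [this work] -/
theorem evB_nonneg {d : ℕ} {c : (Fin m → Fin (d + 1)) → ℤ} (hc : ∀ k, 0 ≤ c k) {x : Fin m → ℝ} (hx : InCube x) :
    0 ≤ evB d c x :=
  Finset.sum_nonneg fun k _ =>
    mul_nonneg (by exact_mod_cast hc k) (Finset.prod_nonneg fun i _ => bernW_nonneg d (hx i) (k i))

/-- The unit vector of degree `0` (the constant polynomial `1`). [this work] -/
def delta0 : (Fin m → Fin 1) → ℤ := fun _ => 1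

/-- `evB 0 delta0 x = 1`. [this work] -/
theorem evB_delta0 (x : Fin m → ℝ) : evB 0 (delta0 (m := m)) x = 1 := by
  unfold evB delta0
  have hk : ∀ k : Fin m → Fin (0 + 1), (∏ i, bernW 0 (x i) (k i)) = 1 := fun k =>
    Finset.prod_eq_one fun i _ => by
      rw [show ((k i : Fin (0 + 1)) : ℕ) = 0 by have := (k i).2; omega, bernW_zero]
  simp only [Int.cast_one, hk, Finset.sum_const, Finset.card_univ, Fintype.card_fun, Fintype.card_fin,
    Nat.zero_add, one_pow, nsmul_eq_mul, Nat.cast_one, mul_one]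

/-! ## Multiplying a coefficient vector by a corner table -/

/-- Raising a degree-`d` key by a corner: `(k + g)_i = k_i + g_i`. [this work] -/
def liftKey {d : ℕ} (k : Fin m → Fin (d + 1)) (g : Fin m → Bool) : Fin m → Fin (d + 2) :=
  fun i => ⟨k i + (g i).toNat, by have := (k i).2; cases g i <;> simp <;> omega⟩

/-- The clamped difference key `K − g` (a genuine preimage iff `liftKey (subKey K g) g = K`). [this work] -/
def subKey {d : ℕ} (K : Fin m → Fin (d + 2)) (g : Fin m → Bool) : Fin m → Fin (d + 1) :=
  fun i => ⟨min ((K i : ℕ) - (g i).toNat) d, by omega⟩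

/-- `subKey` inverts `liftKey`. [this work] -/
theorem subKey_liftKey {d : ℕ} (k : Fin m → Fin (d + 1)) (g : Fin m → Bool) : subKey (liftKey k g) g = k := by
  funext i
  apply Fin.ext
  have := (k i).2
  simp only [subKey, liftKey]
  omega

/-- The product of a degree-`d` coefficient vector with a corner table `T`, as a degree-`(d+1)` coefficient vector:
`(c ⋆ T)_K = Σ_{k + g = K} c_k T_g`. [this work] -/
def convT (d : ℕ) (c : (Fin m → Fin (d + 1)) → ℤ) (T : (Fin m → Bool) → ℤ) : (Fin m → Fin (d + 2)) → ℤ :=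
  fun K => ∑ g, if liftKey (subKey K g) g = K then c (subKey K g) * T g else 0

/-- **Regrouping**: pairing `convT c T` with any weight `W` of degree-`(d+1)` keys is the double sum over `(k, g)` with weight
`W (k + g)`. [this work] -/
theorem sum_convT_mul {R : Type*} [CommRing R] {d : ℕ} (c : (Fin m → Fin (d + 1)) → ℤ) (T : (Fin m → Bool) → ℤ)
    (W : (Fin m → Fin (d + 2)) → R) :
    ∑ K, (convT d c T K : R) * W K = ∑ k, ∑ g, (c k : R) * (T g : R) * W (liftKey k g) := by
  classical
  -- for a fixed corner `g`, the keys `K` hit by `liftKey · g` are parametrised by `k`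
  have hfib : ∀ g : Fin m → Bool,
      ∑ K, (if liftKey (subKey K g) g = K then (c (subKey K g) : R) * (T g : R) else 0) * W K
        = ∑ k, (c k : R) * (T g : R) * W (liftKey k g) := by
    intro g
    have h2 : ∀ k : Fin m → Fin (d + 1), (c k : R) * (T g : R) * W (liftKey k g)
        = ∑ K, (if liftKey k g = K then (c k : R) * (T g : R) * W K else 0) := by
      intro k
      rw [Finset.sum_ite_eq]
      simp
    simp_rw [h2]
    rw [Finset.sum_comm]
    refine Finset.sum_congr rfl fun K _ => ?_
    by_cases hK : liftKey (subKey K g) g = K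
    · rw [if_pos hK, Finset.sum_eq_single (subKey K g)]
      · rw [if_pos hK]
      · intro k _ hk
        rw [if_neg]
        intro hkK
        apply hk
        rw [← hkK, subKey_liftKey]
      · intro h; exact absurd (Finset.mem_univ _) h
    · rw [if_neg hK, zero_mul]
      symm
      refine Finset.sum_eq_zero fun k _ => ?_
      rw [if_neg]
      intro hkK
      apply hK
      rw [← hkK, subKey_liftKey]
  unfold convT
  push_cast
  simp_rw [Finset.sum_mul]
  rw [Finset.sum_comm]
  simp_rw [ite_mul, zero_mul]
  refine (Finset.sum_congr rfl fun g _ => ?_).trans Finset.sum_comm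
  rw [← hfib g]
  refine Finset.sum_congr rfl fun K _ => ?_
  split_ifs <;> simp

/-- **Multiplication by a table in the Bernstein basis**: `evB (d+1) (c ⋆ T) x = evB d c x · ML T x`. [this work] -/
theorem evB_convT {d : ℕ} (c : (Fin m → Fin (d + 1)) → ℤ) (T : (Fin m → Bool) → ℤ) (x : Fin m → ℝ) :
    evB (d + 1) (convT d c T) x = evB d c x * ML (fun g => (T g : ℝ)) x := by
  unfold evB ML
  rw [sum_convT_mul, Finset.sum_mul_sum]
  refine Finset.sum_congr rfl fun k _ => Finset.sum_congr rfl fun g _ => ?_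
  have hW : ∏ i, bernW (d + 1) (x i) (liftKey k g i) = (∏ i, bernW d (x i) (k i)) * mono x g := by
    unfold mono
    rw [← Finset.prod_mul_distrib]
    refine Finset.prod_congr rfl fun i _ => ?_
    rw [show ((liftKey k g i : Fin (d + 2)) : ℕ) = (k i : ℕ) + (g i).toNat from rfl]
    exact bernW_succ d (x i) (Nat.lt_succ_iff.mp (k i).2) (g i)
  rw [hW]
  ring

/-- A bound on the product: `|c ⋆ T| ≤ 2^m · B` if `|c| ≤ B` and `|T| ≤ 1`. [this work] -/
theorem abs_convT_le {d : ℕ} {c : (Fin m → Fin (d + 1)) → ℤ} {T : (Fin m → Bool) → ℤ} {B : ℤ}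
    (hc : ∀ k, |c k| ≤ B) (hT : ∀ g, |T g| ≤ 1) (K : Fin m → Fin (d + 2)) : |convT d c T K| ≤ 2 ^ m * B := by
  classical
  unfold convT
  have hB0 : 0 ≤ B := le_trans (abs_nonneg _) (hc fun _ => 0)
  have hcard : (Finset.univ : Finset (Fin m → Bool)).card = 2 ^ m := by
    rw [Finset.card_univ, Fintype.card_fun, Fintype.card_bool, Fintype.card_fin]
  calc |∑ g, (if liftKey (subKey K g) g = K then c (subKey K g) * T g else 0)|
      ≤ ∑ g, |(if liftKey (subKey K g) g = K then c (subKey K g) * T g else 0)| := Finset.abs_sum_le_sum_abs _ _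
    _ ≤ ∑ _g : Fin m → Bool, B := by
        refine Finset.sum_le_sum fun g _ => ?_
        split_ifs
        · rw [abs_mul]
          calc |c (subKey K g)| * |T g| ≤ B * 1 :=
                mul_le_mul (hc _) (hT g) (abs_nonneg _) hB0
            _ = B := mul_one B
        · rw [abs_zero]; exact hB0
    _ = 2 ^ m * B := by rw [Finset.sum_const, hcard, nsmul_eq_mul]; push_cast; ring

/-! ## Kronecker numbers with a fixed position base `b` -/

/-- Position of a key in base `b`: `Σ_i k_i b^i`. [this work] -/
def posB (b : ℕ) {d : ℕ} (k : Fin m → Fin (d + 1)) : ℕ := ∑ i, (k i : ℕ) * b ^ (i : ℕ)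

/-- Position of a corner in base `b`: `Σ_i g_i b^i`. [this work] -/
def cornerPos (b : ℕ) (g : Fin m → Bool) : ℕ := ∑ i, (g i).toNat * b ^ (i : ℕ)

/-- Positions add: `posB (k + g) = posB k + cornerPos g`. [this work] -/
theorem posB_liftKey (b : ℕ) {d : ℕ} (k : Fin m → Fin (d + 1)) (g : Fin m → Bool) :
    posB b (liftKey k g) = posB b k + cornerPos b g := by
  unfold posB cornerPos
  rw [← Finset.sum_add_distrib]
  refine Finset.sum_congr rfl fun i _ => ?_
  rw [show ((liftKey k g i : Fin (d + 2)) : ℕ) = (k i : ℕ) + (g i).toNat from rfl]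
  ring

/-- The Kronecker number of a degree-`d` coefficient vector in base `M`, positions in base `b`. [this work] -/
def krB (b M : ℕ) (d : ℕ) (c : (Fin m → Fin (d + 1)) → ℤ) : ℤ := ∑ k, c k * (M : ℤ) ^ posB b k

/-- The Kronecker number of an integer corner table in base `M`, positions in base `b`. [this work] -/
def KRB (b M : ℕ) (T : (Fin m → Bool) → ℤ) : ℤ := ∑ g, T g * (M : ℤ) ^ cornerPos b g

/-- **Multiplication by a table in Kronecker numbers**: `krB (c ⋆ T) = krB c · KRB T` (same position base; exact). [this work] -/
theorem krB_convT (b M : ℕ) {d : ℕ} (c : (Fin m → Fin (d + 1)) → ℤ) (T : (Fin m → Bool) → ℤ) :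
    krB b M (d + 1) (convT d c T) = krB b M d c * KRB b M T := by
  unfold krB KRB
  have h := sum_convT_mul (R := ℤ) c T (fun K => (M : ℤ) ^ posB b K)
  simp only [Int.cast_id] at h
  rw [h, Finset.sum_mul_sum]
  refine Finset.sum_congr rfl fun k _ => Finset.sum_congr rfl fun g _ => ?_
  rw [posB_liftKey, pow_add]
  ring

/-- `krB` of the degree-`0` unit vector is `1`. [this work] -/
theorem krB_delta0 (b M : ℕ) : krB b M 0 (delta0 (m := m)) = 1 := by
  unfold krB delta0
  have hk : ∀ k : Fin m → Fin (0 + 1), posB b k = 0 := fun k => by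
    unfold posB
    exact Finset.sum_eq_zero fun i _ => by
      rw [show ((k i : Fin (0 + 1)) : ℕ) = 0 by have := (k i).2; omega, zero_mul]
  simp only [hk, pow_zero, Finset.sum_const, Finset.card_univ, Fintype.card_fun, Fintype.card_fin,
    Nat.zero_add, one_pow, nsmul_eq_mul, Nat.cast_one, mul_one]

/-! ## The digit criterion at position base `d + 1` -/

/-- At base `b = d + 1` the position of a degree-`d` key is Mathlib's `finFunctionFinEquiv`. [this work] -/
theorem posB_eq {d : ℕ} (k : Fin m → Fin (d + 1)) : posB (d + 1) k = (finFunctionFinEquiv k : ℕ) := by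
  rw [finFunctionFinEquiv_apply]; rfl

/-- **Digit criterion (every degree).**  If every coefficient is `< K = 2^(σ-1)` in absolute value,
`krB (d+1) (2^σ) d c + K·Σ_{j<(d+1)^m} (2^σ)^j` equals the natural number `N`, and all `(d+1)^m` lowest base-`2^σ` digits of `N` are
`≥ K`, then every coefficient is nonnegative. [this work] -/
theorem coef_nonneg_of_digit_ge {d : ℕ} {c : (Fin m → Fin (d + 1)) → ℤ} {σ : ℕ} (hσ : 0 < σ)
    (hB : ∀ k, |c k| < 2 ^ (σ - 1)) (N : ℕ)
    (hN : (N : ℤ) = krB (d + 1) (2 ^ σ) d c + ∑ j : Fin ((d + 1) ^ m), (2 : ℤ) ^ (σ - 1) * (2 ^ σ) ^ (j : ℕ))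
    (hdig : ∀ j : ℕ, j < (d + 1) ^ m → 2 ^ (σ - 1) ≤ digit (2 ^ σ) N j) :
    ∀ k, 0 ≤ c k := by
  have hK2 : (2 : ℕ) ^ σ = 2 * 2 ^ (σ - 1) := by
    rw [← pow_succ']; congr 1; omega
  let dg : Fin ((d + 1) ^ m) → ℕ := fun j => (c (finFunctionFinEquiv.symm j) + 2 ^ (σ - 1)).toNat
  have hdnn : ∀ k, 0 ≤ c k + 2 ^ (σ - 1) := fun k => by
    have := (abs_lt.1 (hB k)).1; linarith
  have hK2z : (2 : ℤ) ^ σ = 2 * 2 ^ (σ - 1) := by exact_mod_cast hK2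
  have hdlt : ∀ j, dg j < 2 ^ σ := fun j => by
    have h1 := (abs_lt.1 (hB (finFunctionFinEquiv.symm j))).2
    have h2 := hdnn (finFunctionFinEquiv.symm j)
    have h3 : ((dg j : ℕ) : ℤ) < (2 : ℤ) ^ σ := by
      simp only [dg]
      rw [Int.toNat_of_nonneg h2, hK2z]
      linarith
    exact_mod_cast h3
  have hNsum : N = ∑ j : Fin ((d + 1) ^ m), dg j * (2 ^ σ) ^ (j : ℕ) := by
    zify
    rw [hN]
    unfold krB
    rw [← (Equiv.sum_comp finFunctionFinEquiv.symm (fun k => c k * ((2 ^ σ : ℕ) : ℤ) ^ posB (d + 1) k)),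
      ← Finset.sum_add_distrib]
    refine Finset.sum_congr rfl fun j _ => ?_
    have hEj : posB (d + 1) (finFunctionFinEquiv.symm j) = (j : ℕ) := by
      rw [posB_eq, Equiv.apply_symm_apply]
    rw [hEj]
    simp only [dg]
    rw [Int.toNat_of_nonneg (hdnn _)]
    push_cast
    ring
  intro k
  have hj := hdig (finFunctionFinEquiv k) (finFunctionFinEquiv k).2
  rw [hNsum] at hj
  have hdd := digit_of_sum _ (pow_pos (by norm_num) σ) _ dg hdlt (finFunctionFinEquiv k)
  rw [hdd] at hj
  have h2 := hdnn k
  simp only [dg, Equiv.symm_apply_apply] at hj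
  zify at hj
  rw [Int.toNat_of_nonneg h2] at hj
  linarith

/-! ## Fast Kronecker numbers of list tables (any position base), by shifts -/

/-- `cornerPos` of a `snoc`. [this work] -/
theorem cornerPos_snoc (b : ℕ) (g : Fin m → Bool) (β : Bool) :
    cornerPos b (Fin.snoc g β : Fin (m + 1) → Bool) = cornerPos b g + β.toNat * b ^ m := by
  unfold cornerPos
  rw [Fin.sum_univ_castSucc]
  simp only [Fin.snoc_castSucc, Fin.snoc_last, Fin.val_castSucc, Fin.val_last]

/-- Fast base-`2^s` Kronecker number (positions in base `b`) of an integer list-table of length `2^L`. [this work] -/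
def krLB (s b : ℕ) : ℕ → List ℤ → ℤ
  | 0, l => l.getD 0 0
  | L + 1, l => krLB s b L (l.take (2 ^ L)) + krLB s b L (l.drop (2 ^ L)) * (2 : ℤ) ^ (s * b ^ L)

/-- **Correctness of `krLB`**: `krLB s b L l = KRB b (2^s) (tabOf l)` for `l.length = 2^L`. [this work] -/
theorem krLB_eq (s b : ℕ) : ∀ (L : ℕ) (l : List ℤ), l.length = 2 ^ L → krLB s b L l = KRB b (2 ^ s) (tabOf (m := L) l)
  | 0, l, hl => by
    unfold krLB KRB tabOf
    simp [enc2, cornerPos]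
  | L + 1, l, hl => by
    have h1 : (l.take (2 ^ L)).length = 2 ^ L := by rw [List.length_take, hl, pow_succ]; omega
    have h2 : (l.drop (2 ^ L)).length = 2 ^ L := by rw [List.length_drop, hl, pow_succ]; omega
    unfold krLB
    rw [krLB_eq s b L _ h1, krLB_eq s b L _ h2]
    unfold KRB
    rw [sum_corner_succ, Finset.sum_mul]
    congr 1
    · refine Finset.sum_congr rfl fun g _ => ?_
      unfold tabOf
      rw [enc2_snoc, cornerPos_snoc]
      simp only [Bool.toNat_false, zero_mul, add_zero]
      rw [List.getD_eq_getElem?_getD, List.getD_eq_getElem?_getD, List.getElem?_take_of_lt (enc2_lt g)]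
    · refine Finset.sum_congr rfl fun g _ => ?_
      unfold tabOf
      rw [enc2_snoc, cornerPos_snoc]
      simp only [Bool.toNat_true, one_mul]
      rw [List.getD_eq_getElem?_getD, List.getD_eq_getElem?_getD, List.getElem?_drop, add_comm (2 ^ L),
        pow_add, mul_assoc, two_pow_mul_cast]

/-- Fast Kronecker number of a list-table of NATURALS (positions in base `b`), by shifts. [this work] -/
def krNB (s b : ℕ) : ℕ → List ℕ → ℕ
  | 0, l => l.getD 0 0
  | L + 1, l => krNB s b L (l.take (2 ^ L)) + (krNB s b L (l.drop (2 ^ L))) <<< (s * b ^ L)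

/-- `krNB` agrees with `krLB` on the casts. [this work] -/
theorem krNB_eq_krLB (s b : ℕ) : ∀ (L : ℕ) (l : List ℕ), (krNB s b L l : ℤ) = krLB s b L (l.map ((↑) : ℕ → ℤ))
  | 0, l => by simp [krNB, krLB, List.getD_eq_getElem?_getD, List.getElem?_map]; cases l[0]? <;> simp
  | L + 1, l => by
    unfold krNB krLB
    rw [Nat.shiftLeft_eq, ← List.map_take, ← List.map_drop]
    push_cast
    rw [krNB_eq_krLB s b L, krNB_eq_krLB s b L]

/-- **Correctness of `krNB`.** [this work] -/
theorem krNB_eq (s b L : ℕ) (l : List ℕ) (hl : l.length = 2 ^ L) :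
    (krNB s b L l : ℤ) = KRB b (2 ^ s) (tabOf (m := L) (l.map ((↑) : ℕ → ℤ))) := by
  rw [krNB_eq_krLB, krLB_eq s b L _ (by rw [List.length_map, hl])]

/-- Kronecker number (base `2^σ`, positions in base `b`) of a bitmask table of the `m`-cube. [this work] -/
def krTB (σ b m T : ℕ) : ℕ := krNB σ b m (tabN m T)

/-- `krTB` is the Kronecker number `KRB` of the corner table. [this work] -/
theorem krTB_eq (σ b m T : ℕ) : (krTB σ b m T : ℤ) = KRB b (2 ^ σ) (tabZ m T) := krNB_eq σ b m _ (length_tabN m T)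

end Summit.CriticalPhenomena.PercolationContinuityZ3.Theorems.NCopyCert
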